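/-
Origin: expansion seat `planner-pub-hodgecm-mc-sanity-1-g2-0`, handover #1r 2026-08-18T21:16Z md5 28417682c1b3c2f375cb5c01ebfb5796 SUPERSEDES 81fd0d7aa931 (+§4 E-term binder profile, additive; NEW, 279 l., 20 decls; imports HodgeCM.Model.Binders.MeetBridges (binder-1-g2 t33-mcbinder1g2 #1) + HodgeCM.Model.Sanity.MeetRecord (gen-1 t32-mcsanity1); INSTALL AFTER both; compiled rc 0 in 6 s against PKG r31 + overlay oleans of exactly those sources (MeetBridges = f871b65069 (`HOME/mc/pub-hodgecm-mc-sanity-1-g2/lean/BridgeSanity.lean`, md5 28417682, 279 lines);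
landed by the packager successor (mc-unitary-1-g3, gen-8 kit) in gate run 32 as `HodgeCM/Model/Sanity/BridgeSanity.lean` (stripped 7 #print/#check/#eval lines).
-/
import Summits.HodgeConjecture.HodgeCM.Model.Binders.MeetBridges
import Summits.HodgeConjecture.HodgeCM.Model.Sanity.MeetRecord

/-
Copyright: pub-hodgecm MODEL-CONSTRUCTION cell, 2026-08-18. Seat planner-pub-hodgecm-mc-sanity-1-g2-0 (node SAN-4:
degenerate-instance sanity of the gen-2 function-level bridges, OFF the E path). KERNEL ONLY: 0 records cited,
0 hypotheses minted, 0 proof holes.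

# Sanity rows for the B2-meet bridges `Gen12FunBridge` / `Real34FunBridge` (binder-1-g2 `Model/Binders/MeetBridges.lean`,
md5 a3bffb408f38 as installed = source f871b65069bc with the one import line re-targeted)

Intended install path `HodgeCM/Model/Sanity/BridgeSanity.lean` (additive leaf). Imports the bridge file and this
lane's gen-1 leaf `Sanity/MeetRecord.lean` (e3014f5fe7d1; hence `PointwiseSanity`, `DegenerateCores`).

QUESTION (payload SAN duty for every new construction): which fields of the two bridge records are LOAD-BEARING and
which are satisfiable by the zero / degenerate datum?  Answer, kernel-checked below, at a context `(V, c)` of the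
constructed model `C.thetaModel h d12 d34` of an adelic theta core `C`:

§1 `Real34FunBridge` (row hQ): INHABITED at every zero-kernel context by `wset := ∅` (`gen_mem`: `ϑ₃₄ = 0 ∈ closure ⊥`;
   `meet`: no `P ∈ ∅`) — `real34FunBridge_of_zeroKernelsAt`; and for ANY core by `wset := ∅` as soon as `ϑ₃₄ ≡ 0`.
   So neither field of the (34) bridge sees `emb`, `cover` or `Theta`: on its own it carries no non-degeneracy.
§2 `Gen12FunBridge` (row hbr): at a zero-kernel context a bridge EXISTS iff `Λ_Γ` kills every theta pair
   (`nonempty_gen12FunBridge_iff_of_zeroKernelsAt`, needs one character `χ₀ : X` for the vacuous generator when a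
   theta pair exists) — i.e. iff C5′ `Gen12MeetAt V c` itself holds there (`…_iff_gen12MeetAt_of_zeroKernelsAt`):
   the record is EXACTLY as strong as its target at degenerate contexts; the witness is `wf := 0`, and the field that
   FAILS for `wf := 0` once some theta wedge has `Λ ≠ 0` is `proj` (`not_proj_zero_of_Λ_ne_zero`), never `wf_gen`.
   For `emb = 0` at the levels of `V` (any kernels) the bridge is inhabited as soon as one generator value
   `ϑ₁₂(χ₀, Φ₀)` can be named (`gen12FunBridge_of_emb_eq_zero`: `wf := ϑ₁₂(χ₀, Φ₀)`, `proj` with `Λ = 0`).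
§3 NO-GO through the bridges: over the five PerL model facts and HR(2,0), zero kernels at ONE good `S`-context are
   incompatible with C2 + C3 + C4 + `Nonempty (Gen12FunBridge V c)` (`false_of_zeroKernelsAt_funBridge`), and the
   ₁₀ headline's bridge form `AllCharsNonDesignPt₂.ofFunBridges` is never fed by a zero-kernel core at a good sextic
   context (`not_ofFunBridges_input_of_zeroKernelsAt`).  Hence, as for E3/E4: the non-degeneracy content entering
   `Assembly.perL_ofFunBridges₁₀` is C2 (`InnerEmbAt`) + C4 (`thetaWedge`) + the kernels `wm`; the bridges are
   load-bearing only through `proj` (12) and `meet` (34) AT theta pairs with `Λ ≠ 0`, whose existence C2 + C4 force.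
§4 BINDER PROFILE of the E term (`perL_ofFunBridges₁₀`; node E `Model.perL_picardCM` has the same six property binders):
   for the fully degenerate core `C.degenerate₀` (given `emb`, `cover`; degenerate Weil theta models; `Theta := ∅`)
   the binders `thetaSub`, `gen12`, `real34`, `occ` hold at EVERY context (`eTerm_binders_degenerate₀`) and
   `thetaWedge` fails at every context (`not_eTerm_thetaWedge_degenerate₀`); `innerEmb` reads `emb` only.
-/

set_option autoImplicit false

noncomputable section

open HodgeCM HodgeCM.Universe MeasureTheory
open scoped InnerProductSpace

attribute [-instance] Quotient.instMeasurableSpace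

namespace HodgeCM

namespace Universe.ThetaModel

variable {U : Universe} (T : U.ThetaModel) {L : CMField} {ι₁ : L →+* ℂ} {V : HermSpace3 L ι₁} {c : SeesawCtx L}

/-! ## §1 The (34) bridge is inhabited as soon as `ϑ₃₄ ≡ 0` -/

/-- `Real34FunBridge` with `wset := ∅` for a model whose (34) generators at `(V, c)` all vanish. -/
def real34FunBridge_of_ϑ34_eq_zero
    (h0 : ∀ (χ : (T.t34 V c).X) (Φ : T.SK V c), (T.t34 V c).ϑ χ Φ = 0) : T.Real34FunBridge V c where
  wset := ∅
  gen_mem χ Φ := by rw [h0 χ Φ]; exact Submodule.zero_mem _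
  meet _ _ _ _ _ P hP _ := ((Set.mem_empty_iff_false P).mp hP).elim

/-! ## §2 The (12) bridge: `wf := 0`, and `proj` is the field that sees `Λ` -/

/-- With the ZERO global wedge-function, `proj` at a theta pair holds iff `Λ_Γ(ω₁, ω₂) = 0`. -/
theorem proj_zero_iff (Γ : Level V) (ω₁ ω₂ : U.CohC (U.pms L ι₁ V Γ) 1) :
    (∃ a : ℂ, a ≠ 0 ∧ ⟪T.Λ Γ ω₁ ω₂, (0 : T.HG L ι₁ V)⟫_ℂ = a * ⟪T.Λ Γ ω₁ ω₂, T.Λ Γ ω₁ ω₂⟫_ℂ) ↔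
      T.Λ Γ ω₁ ω₂ = 0 := by
  constructor
  · rintro ⟨a, ha, h⟩
    rw [inner_zero_right, eq_comm, mul_eq_zero, inner_self_eq_zero] at h
    exact h.resolve_left ha
  · intro h
    exact ⟨1, one_ne_zero, by rw [h, inner_zero_left, mul_zero]⟩

/-- `proj` FAILS for `wf := 0` at a theta pair with `Λ ≠ 0`. -/
theorem not_proj_zero_of_Λ_ne_zero (Γ : Level V) (ω₁ ω₂ : U.CohC (U.pms L ι₁ V Γ) 1) (hne : T.Λ Γ ω₁ ω₂ ≠ 0) :
    ¬ ∃ a : ℂ, a ≠ 0 ∧ ⟪T.Λ Γ ω₁ ω₂, (0 : T.HG L ι₁ V)⟫_ℂ = a * ⟪T.Λ Γ ω₁ ω₂, T.Λ Γ ω₁ ω₂⟫_ℂ :=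
  fun h => hne ((T.proj_zero_iff Γ ω₁ ω₂).mp h)

/-- `Gen12FunBridge` with `wf := 0` for a model whose (12) generators at `(V, c)` all vanish, whose `Λ` kills every
theta pair of the context, and which has one character `χ₀` (only used to name the vacuous generator `ϑ₁₂(χ₀, 0) = 0`). -/
def gen12FunBridge_zero (χ₀ : (T.t12 V c).X) (Φ₀ : T.SK V c)
    (h0 : ∀ (χ : (T.t12 V c).X) (Φ : T.SK V c), (T.t12 V c).ϑ χ Φ = 0)
    (hΛ : ∀ (Γ : Level V) (ω₁ ω₂ : U.CohC (U.pms L ι₁ V Γ) 1), ω₁ ∈ T.Theta V c 0 Γ → ω₂ ∈ T.Theta V c 1 Γ →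
      T.Λ Γ ω₁ ω₂ = 0) : T.Gen12FunBridge V c where
  wf _ _ _ := 0
  wf_gen _ _ _ _ _ := ⟨χ₀, Φ₀, (h0 χ₀ Φ₀).symm⟩
  proj Γ ω₁ ω₂ h₁ h₂ := (T.proj_zero_iff Γ ω₁ ω₂).mpr (hΛ Γ ω₁ ω₂ h₁ h₂)

/-- Conversely ANY (12) bridge at a context whose (12) generators vanish forces `Λ` to kill every theta pair
(`wf_gen` ⇒ `wf = 0` there, then `proj`). -/
theorem Λ_eq_zero_of_gen12FunBridge (B : T.Gen12FunBridge V c)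
    (h0 : ∀ (χ : (T.t12 V c).X) (Φ : T.SK V c), (T.t12 V c).ϑ χ Φ = 0)
    (Γ : Level V) (ω₁ ω₂ : U.CohC (U.pms L ι₁ V Γ) 1) (h₁ : ω₁ ∈ T.Theta V c 0 Γ) (h₂ : ω₂ ∈ T.Theta V c 1 Γ) :
    T.Λ Γ ω₁ ω₂ = 0 := by
  obtain ⟨χ, Φ, hgen⟩ := B.wf_gen Γ ω₁ ω₂ h₁ h₂
  have hwf : B.wf Γ ω₁ ω₂ = 0 := by rw [hgen, h0 χ Φ]
  have hp := B.proj Γ ω₁ ω₂ h₁ h₂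
  rw [hwf] at hp
  exact (T.proj_zero_iff Γ ω₁ ω₂).mp hp

/-- For `emb = 0` at the levels of `V` (any kernels) the (12) bridge is inhabited as soon as one generator value is
named: `wf := ϑ₁₂(χ₀, Φ₀)` (constant), `proj` vacuous in content (`Λ = 0`, take `a = 1`). -/
def gen12FunBridge_of_emb_eq_zero (hE : ∀ Γ : Level V, T.emb Γ = 0) (χ₀ : (T.t12 V c).X) (Φ₀ : T.SK V c) :
    T.Gen12FunBridge V c where
  wf _ _ _ := (T.t12 V c).ϑ χ₀ Φ₀
  wf_gen _ _ _ _ _ := ⟨χ₀, Φ₀, rfl⟩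
  proj Γ ω₁ ω₂ _ _ := ⟨1, one_ne_zero, by
    have h : T.Λ Γ ω₁ ω₂ = 0 := by rw [T.Λ_apply Γ, hE Γ, LinearMap.zero_apply]
    rw [h, inner_zero_left, inner_zero_left, mul_zero]⟩

end Universe.ThetaModel

namespace Universe.AdelicThetaCore

variable {U : Universe} {hP : PrintFact_unitaryCompact} {C : U.AdelicThetaCore hP} (h : Bool)
variable (d12 d34 : ∀ {L : CMField}, SeesawCtx L → SideData L)
variable {S : ∀ {L : CMField}, SeesawCtx L → Prop}
variable {L : CMField} {ι₁ : L →+* ℂ} {V : HermSpace3 L ι₁} {c : SeesawCtx L}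

/-! ## §1′ / §2′ At a zero-kernel context of the constructed model -/

/-- **hQ's record is inhabited at every zero-kernel context** (`wset := ∅`). -/
def real34FunBridge_of_zeroKernelsAt (hθ : C.ZeroKernelsAt V c) : (C.thetaModel h d12 d34).Real34FunBridge V c :=
  (C.thetaModel h d12 d34).real34FunBridge_of_ϑ34_eq_zero (C.thetaModel_ϑ34_eq_zero h d12 d34 V c hθ)

/-- **hbr's record at a zero-kernel context EXISTS iff `Λ` kills every theta pair** (given one character `χ₀` and one
`K`-fixed Schwartz datum `Φ₀` of the core at `(V, c)` to name the vacuous generator `ϑ₁₂(χ₀, Φ₀) = 0`; both index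
sets are abstract data of the core and MAY be empty, in which case a bridge exists iff the context has no theta pair). -/
theorem nonempty_gen12FunBridge_iff_of_zeroKernelsAt (hθ : C.ZeroKernelsAt V c)
    (χ₀ : ((C.thetaModel h d12 d34).t12 V c).X) (Φ₀ : (C.wm V c).SK) :
    Nonempty ((C.thetaModel h d12 d34).Gen12FunBridge V c) ↔
      ∀ (Γ : Level V) (ω₁ ω₂ : U.CohC (U.pms L ι₁ V Γ) 1), ω₁ ∈ C.Theta V c 0 Γ → ω₂ ∈ C.Theta V c 1 Γ →
        (C.thetaModel h d12 d34).Λ Γ ω₁ ω₂ = 0 := by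
  constructor
  · rintro ⟨B⟩ Γ ω₁ ω₂ h₁ h₂
    exact (C.thetaModel h d12 d34).Λ_eq_zero_of_gen12FunBridge B (C.thetaModel_ϑ12_eq_zero h d12 d34 V c hθ) Γ ω₁ ω₂
      (by rw [C.thetaModel_Theta h d12 d34]; exact h₁) (by rw [C.thetaModel_Theta h d12 d34]; exact h₂)
  · intro H
    exact ⟨(C.thetaModel h d12 d34).gen12FunBridge_zero χ₀ (show _ from Φ₀) (C.thetaModel_ϑ12_eq_zero h d12 d34 V c hθ)
      fun Γ ω₁ ω₂ h₁ h₂ => H Γ ω₁ ω₂ (by rw [← C.thetaModel_Theta h d12 d34]; exact h₁)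
        (by rw [← C.thetaModel_Theta h d12 d34]; exact h₂)⟩

/-- **… iff C5′ itself holds there**: at degenerate contexts the function-level record adds nothing to, and loses
nothing from, its target `Gen12MeetAt V c` (gen-1 `gen12MeetAt_iff_of_zeroKernelsAt`). -/
theorem nonempty_gen12FunBridge_iff_gen12MeetAt_of_zeroKernelsAt (hθ : C.ZeroKernelsAt V c)
    (χ₀ : ((C.thetaModel h d12 d34).t12 V c).X) (Φ₀ : (C.wm V c).SK) :
    Nonempty ((C.thetaModel h d12 d34).Gen12FunBridge V c) ↔ (C.thetaModel h d12 d34).Gen12MeetAt V c := by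
  rw [nonempty_gen12FunBridge_iff_of_zeroKernelsAt h d12 d34 hθ χ₀ Φ₀, gen12MeetAt_iff_of_zeroKernelsAt h d12 d34 hθ]
  refine forall₅_congr fun Γ ω₁ ω₂ _ _ => ?_
  rw [(C.thetaModel h d12 d34).Λ_apply Γ, C.thetaModel_emb h d12 d34]
  rfl

/-! ## §3 No-go through the bridges -/

/-- **NO-GO, bridge form.**  Over the five PerL model facts and HR(2,0): zero kernels at `(V, c)` are incompatible with
C2 (`InnerEmbAt V`), C3, C4 at `(V, c)` and a (12) function-level bridge at `(V, c)`. -/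
theorem false_of_zeroKernelsAt_funBridge (M : U.ModelAxiomsPerL) (hHR : U.Fact_hodgeRiemann20)
    (hθ : C.ZeroKernelsAt V c) (h₂ : (C.thetaModel h d12 d34).InnerEmbAt V)
    (h₅ : ∀ (i : Fin 4) (Γ : Level V), (C.thetaModel h d12 d34).Theta V c i Γ ⊆ U.Uiso Γ c.K (c.Ψ i) c.σ)
    (h₆ : ∃ Γ : Level V, ∃ ω₁ ∈ (C.thetaModel h d12 d34).Theta V c 0 Γ, ∃ ω₂ ∈ (C.thetaModel h d12 d34).Theta V c 1 Γ,
      U.cup2C (U.pms L ι₁ V Γ) 1 ω₁ ω₂ ≠ 0)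
    (B : (C.thetaModel h d12 d34).Gen12FunBridge V c) : False :=
  false_of_zeroKernelsAt₂ h d12 d34 M hHR hθ h₂ h₅ h₆ ((C.thetaModel h d12 d34).gen12MeetAt_of_funBridge B)

/-- **A zero-kernel core never supplies the six inputs of `AllCharsNonDesignPt₂.ofFunBridges` at a good `S`-context**:
whatever (34) bridge, C3 and C7 data are offered, C2 + C4 + a (12) bridge at `(V, c)` already contradict HR(2,0). -/
theorem not_ofFunBridges_input_of_zeroKernelsAt (M : U.ModelAxiomsPerL) (hHR : U.Fact_hodgeRiemann20)
    (hθ : C.ZeroKernelsAt V c)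
    (h₂ : (C.thetaModel h d12 d34).InnerEmbAt V)
    (h₅ : ∀ (i : Fin 4) (Γ : Level V), (C.thetaModel h d12 d34).Theta V c i Γ ⊆ U.Uiso Γ c.K (c.Ψ i) c.σ)
    (h₆ : ∃ Γ : Level V, ∃ ω₁ ∈ (C.thetaModel h d12 d34).Theta V c 0 Γ, ∃ ω₂ ∈ (C.thetaModel h d12 d34).Theta V c 1 Γ,
      U.cup2C (U.pms L ι₁ V Γ) 1 ω₁ ω₂ ≠ 0) :
    IsEmpty ((C.thetaModel h d12 d34).Gen12FunBridge V c) :=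
  ⟨fun B => false_of_zeroKernelsAt_funBridge h d12 d34 M hHR hθ h₂ h₅ h₆ B⟩

/-- **POINTWISE non-degeneracy witness, bridge form (R2 at C for `perL_ofFunBridges₁₀`)**: C2, C3, C4 and a (12)
bridge at `(V, c)` force a nonzero theta kernel of the core AT `(V, c)`. -/
theorem exists_theta_ne_zero_at_of_funBridge (M : U.ModelAxiomsPerL) (hHR : U.Fact_hodgeRiemann20)
    (h₂ : (C.thetaModel h d12 d34).InnerEmbAt V)
    (h₅ : ∀ (i : Fin 4) (Γ : Level V), (C.thetaModel h d12 d34).Theta V c i Γ ⊆ U.Uiso Γ c.K (c.Ψ i) c.σ)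
    (h₆ : ∃ Γ : Level V, ∃ ω₁ ∈ (C.thetaModel h d12 d34).Theta V c 0 Γ, ∃ ω₂ ∈ (C.thetaModel h d12 d34).Theta V c 1 Γ,
      U.cup2C (U.pms L ι₁ V Γ) 1 ω₁ ω₂ ≠ 0)
    (B : (C.thetaModel h d12 d34).Gen12FunBridge V c) :
    ∃ (Φ : (C.wm V c).SK) (p : _), (C.wm V c).θ Φ p ≠ 0 :=
  exists_theta_ne_zero_at_of_local₂ h d12 d34 M hHR h₂ h₅ h₆ ((C.thetaModel h d12 d34).gen12MeetAt_of_funBridge B)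

/-- **The (34) bridge alone carries no non-degeneracy**: the degenerate placeholder core `withDegenerateWM` (any `emb`,
`cover`, `Theta`) has a (34) bridge at EVERY context. -/
def real34FunBridge_withDegenerateWM (C : U.AdelicThetaCore hP) (V : HermSpace3 L ι₁) (c : SeesawCtx L) :
    (C.withDegenerateWM.thetaModel h d12 d34).Real34FunBridge V c :=
  real34FunBridge_of_zeroKernelsAt h d12 d34 (C.withDegenerateWM_zeroKernelsAt V c)

/-- For the degenerate placeholder core the Schwartz datum is `() ∈ univ`, so at each context hbr's record exists iff
C5′ holds iff `emb` kills every theta wedge (one character `χ₀` still names the vacuous generator). -/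
theorem nonempty_gen12FunBridge_withDegenerateWM_iff (C : U.AdelicThetaCore hP) (V : HermSpace3 L ι₁) (c : SeesawCtx L)
    (χ₀ : ((C.withDegenerateWM.thetaModel h d12 d34).t12 V c).X) :
    Nonempty ((C.withDegenerateWM.thetaModel h d12 d34).Gen12FunBridge V c) ↔
      ∀ (Γ : Level V) (ω₁ ω₂ : U.CohC (U.pms L ι₁ V Γ) 1), ω₁ ∈ C.Theta V c 0 Γ → ω₂ ∈ C.Theta V c 1 Γ →
        C.emb Γ (U.cup2C (U.pms L ι₁ V Γ) 1 ω₁ ω₂) = 0 := by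
  rw [nonempty_gen12FunBridge_iff_gen12MeetAt_of_zeroKernelsAt h d12 d34 (C.withDegenerateWM_zeroKernelsAt V c) χ₀
    ⟨(), Set.mem_univ _⟩, gen12MeetAt_iff_of_zeroKernelsAt h d12 d34 (C.withDegenerateWM_zeroKernelsAt V c)]
  rfl

/-! ## §4 Binder profile of the E term (`Assembly.perL_ofFunBridges₁₀`, node E `Model.perL_picardCM`) -/

section ETerm

variable (C : U.AdelicThetaCore hP)

/-- The FULLY DEGENERATE core: the given `emb`, `cover`, DEGENERATE Weil theta models and EMPTY theta sets. -/
def degenerate₀ : U.AdelicThetaCore hP :=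
  ⟨C.emb, C.cover, fun _ _ => degenerateWeilThetaModel _ _ _ _, fun _ _ _ _ => ∅⟩

/-- (Ported verbatim from the HodgeCMPerL package; no docstring in the source.) -/
@[simp] theorem degenerate₀_Theta (V : HermSpace3 L ι₁) (c : SeesawCtx L) (i : Fin 4) (Γ : Level V) :
    C.degenerate₀.Theta V c i Γ = ∅ := rfl

/-- (Ported verbatim from the HodgeCMPerL package; no docstring in the source.) -/
theorem degenerate₀_zeroKernelsAt (V : HermSpace3 L ι₁) (c : SeesawCtx L) : C.degenerate₀.ZeroKernelsAt V c :=
  fun Φ => degenerateWeilThetaModel_θ _ _ _ _ Φ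

/-- (Ported verbatim from the HodgeCMPerL package; no docstring in the source.) -/
theorem degenerate₀_thetaModel_Theta (V : HermSpace3 L ι₁) (c : SeesawCtx L) (i : Fin 4) (Γ : Level V) :
    (C.degenerate₀.thetaModel h d12 d34).Theta V c i Γ = ∅ := by
  rw [C.degenerate₀.thetaModel_Theta h d12 d34]; rfl

/-- **Four of the six property binders of the E term hold for the fully degenerate core at EVERY context** (no
`GoodCtx`, no `S`): `thetaSub` (C3: `∅ ⊆ U_Ψ`), `gen12` (C5′ bridge: vacuous, `wf := 0`), `real34` (C6′ bridge:
`wset := ∅`), `occ` (C7 pair: `𝒯_Φ = 0`).  Any `emb`, any `cover`, any universe. -/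
theorem eTerm_binders_degenerate₀ (V : HermSpace3 L ι₁) (c : SeesawCtx L) :
    (∀ (i : Fin 4) (Γ : Level V), (C.degenerate₀.thetaModel h d12 d34).Theta V c i Γ ⊆ U.Uiso Γ c.K (c.Ψ i) c.σ) ∧
    Nonempty ((C.degenerate₀.thetaModel h d12 d34).Gen12FunBridge V c) ∧
    Nonempty ((C.degenerate₀.thetaModel h d12 d34).Real34FunBridge V c) ∧
    ((∀ (Φ : (C.degenerate₀.thetaModel h d12 d34).SK V c) (i : (C.degenerate₀.thetaModel h d12 d34).SigIdx V c),
        (∃ v ∈ ((C.degenerate₀.thetaModel h d12 d34).core V c).hatσ i,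
          ((C.degenerate₀.thetaModel h d12 d34).core V c).TΦ Φ v ≠ 0) →
        ((C.degenerate₀.thetaModel h d12 d34).t12 V c).wOccurs i) ∧
      (∀ (Φ : (C.degenerate₀.thetaModel h d12 d34).SK V c) (i : (C.degenerate₀.thetaModel h d12 d34).SigIdx V c),
        (∃ v ∈ ((C.degenerate₀.thetaModel h d12 d34).core V c).hatσ i,
          ((C.degenerate₀.thetaModel h d12 d34).core V c).TΦ Φ v ≠ 0) →
        ((C.degenerate₀.thetaModel h d12 d34).t34 V c).wOccurs i)) := by
  have hθ := C.degenerate₀_zeroKernelsAt V c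
  refine ⟨fun i Γ => ?_, ⟨⟨fun _ _ _ => 0, fun Γ ω₁ _ h₁ _ => ?_, fun Γ ω₁ _ h₁ _ => ?_⟩⟩,
    ⟨real34FunBridge_of_zeroKernelsAt h d12 d34 hθ⟩, fun Φ i hv => ?_, fun Φ i hv => ?_⟩
  · rw [C.degenerate₀_thetaModel_Theta h d12 d34]; exact Set.empty_subset _
  · rw [C.degenerate₀_thetaModel_Theta h d12 d34] at h₁; exact h₁.elim
  · rw [C.degenerate₀_thetaModel_Theta h d12 d34] at h₁; exact h₁.elim
  · obtain ⟨v, -, hv⟩ := hv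
    exact (hv (C.degenerate₀.thetaModel_TΦ_eq_zero h d12 d34 V c hθ Φ v)).elim
  · obtain ⟨v, -, hv⟩ := hv
    exact (hv (C.degenerate₀.thetaModel_TΦ_eq_zero h d12 d34 V c hθ Φ v)).elim

/-- … while the binder `thetaWedge` (C4) FAILS for it at every context (and `innerEmb` (C2) is untouched: it reads
`emb` only).  Together with `false_of_zeroKernelsAt_funBridge`: an E term has content exactly through its C2 and C4
binders (and the kernels they force). -/
theorem not_eTerm_thetaWedge_degenerate₀ (V : HermSpace3 L ι₁) (c : SeesawCtx L) :
    ¬ ∃ Γ : Level V, ∃ ω₁ ∈ (C.degenerate₀.thetaModel h d12 d34).Theta V c 0 Γ,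
        ∃ ω₂ ∈ (C.degenerate₀.thetaModel h d12 d34).Theta V c 1 Γ, U.cup2C (U.pms L ι₁ V Γ) 1 ω₁ ω₂ ≠ 0 := by
  rintro ⟨Γ, ω₁, h₁, -⟩
  rw [C.degenerate₀_thetaModel_Theta h d12 d34] at h₁
  exact h₁

end ETerm

end Universe.AdelicThetaCore

end HodgeCM

end

/-! ## Axiom audit (expected: `propext`, `Classical.choice`, `Quot.sound` only) -/
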